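import Summits.CriticalPhenomena.Ising3D.IsingColumnFaceL11CensusSegmentAlgA
import Summits.CriticalPhenomena.Ising3D.IsingColumnFaceL11CensusSegmentAlgB
import Summits.CriticalPhenomena.Ising3D.IsingColumnFaceL11CensusSegmentAlgC
import Summits.CriticalPhenomena.Ising3D.IsingColumnFaceL11CensusSegmentAlgD

/-!
# The `ALG` census of §7.3 on the certified `Δε` segment as kernel facts, VII: the last kernel evaluations
and the theorems (cell `pub-ising3x`, seat recog-1; paper §7.1 / §7.3)

HONEST FRAMING: lottery ticket; floor = tightest certified 3D Ising CFT bounds; no exact-solution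
claim without a proof. Island framing: certified exclusion region at stated derivative order and
assumptions; not a determination of the 3D Ising critical exponents beyond that.

The last five kernel evaluations of the machine of `IsingColumnFaceL11CensusSegmentAlg.lean` ((rung,
sub-window) pairs `(3,0)`, `(3,1)`, `(3,2)`, `(5,1)`, `(5,2)`; ≈ 140 s of kernel time) and the ASSEMBLY of all eighteen
(`…SegmentAlgA/B/C/D.lean`):
* `algDescrSet (d, H) k` — the DESCRIPTIONS `(P, ξ)` of rung `(d, H)` (`P` a coefficient list of degree `d`,
  height `≤ H`, positive top coefficient, content `1`; `ξ` a real root of `P`) with `ξ` in the closed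
  sub-window `k`; `alg_ncard_rungs` (rungs are disjoint by degree), `alg_rung_ncard` (the eighteen counts,
  each a FINITE set counted exactly);
* **`alg_descr_subwindow_ncard`: §7.3's «17 867 / 24 584 / 20 260» are kernel facts** — exactly that many
  descriptions of the table `ALG` (`(d, H) ∈ algTable`) have their root in `[81/64, 13/10]` /
  `[13/10, 27/20]` / `[27/20, 2855/2048]` (by rung: `6657+6713+1617+1827+630+423`,
  `9090+9337+2244+2484+857+572`, `7468+7802+1844+2022+681+443`); `alg_descr_rung6_ncard`.
A statement about the frozen catalogue's density on the certified segment, NOT about `Δε`; nothing is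
recognised; no P(M·) relevance. Real analysis and arithmetic over landed definitions; no certificate, no
datum, no σ–ε axiom.
lottery ticket; floor = tightest certified 3D Ising CFT bounds; no exact-solution claim without a proof.
-/

namespace Summit.CriticalPhenomena.Ising3D
namespace ColumnFaceL11
open Set Literature.MathematicalPhysics.QuantumFieldTheory.ConformalBootstrap3D

/-- Rung `(d, H) = (3, 12)`, sub-window `[81/64, 13/10]`: every candidate counted, codes increasing, the primitive
candidates have `1617` roots in the window in total. [folklore] -/
theorem algSegCheck_3_0 : algSegCheck 3 12 0 1617 = true := by
  decide +kernel

/-- Rung `(d, H) = (3, 12)`, sub-window `[13/10, 27/20]`: every candidate counted, codes increasing, the primitive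
candidates have `2244` roots in the window in total. [folklore] -/
theorem algSegCheck_3_1 : algSegCheck 3 12 1 2244 = true := by
  decide +kernel

/-- Rung `(d, H) = (3, 12)`, sub-window `[27/20, 2855/2048]`: every candidate counted, codes increasing, the primitive
candidates have `1844` roots in the window in total. [folklore] -/
theorem algSegCheck_3_2 : algSegCheck 3 12 2 1844 = true := by
  decide +kernel

/-- Rung `(d, H) = (5, 3)`, sub-window `[13/10, 27/20]`: every candidate counted, codes increasing, the primitive
candidates have `857` roots in the window in total. [folklore] -/
theorem algSegCheck_5_1 : algSegCheck 5 3 1 857 = true := by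
  decide +kernel

/-- Rung `(d, H) = (5, 3)`, sub-window `[27/20, 2855/2048]`: every candidate counted, codes increasing, the primitive
candidates have `681` roots in the window in total. [folklore] -/
theorem algSegCheck_5_2 : algSegCheck 5 3 2 681 = true := by
  decide +kernel

/-! ### From the eighteen checks to the census numbers -/

/-- The descriptions of rung `(d, H)` with root in the closed sub-window `k`. [folklore] -/
def algDescrSet (dH : ℕ × ℕ) (k : ℕ) : Set (List ℤ × ℝ) :=
  {p | algDescrOK dH.1 dH.2 p.1 = true ∧ p.2 ∈ rootsIn p.1 (segCutQ k) (segCutQ (k + 1))}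

/-- A description polynomial of rung `(d, H)` has length `d + 1` (so the rungs are disjoint). [folklore] -/
theorem length_of_algDescrOK {d H : ℕ} {c : List ℤ} (h : algDescrOK d H c = true) : c.length = d + 1 := by
  simp only [algDescrOK, algPolyOK, Bool.and_eq_true, decide_eq_true_eq] at h
  exact h.1.1.1.1.1

/-- Counting over a list of rungs with distinct degrees: the union is disjoint. [folklore] -/
theorem alg_ncard_rungs (k : ℕ) : ∀ (T : List (ℕ × ℕ)), (T.map Prod.fst).Nodup →
    (∀ dH ∈ T, (algDescrSet dH k).Finite) →
    {p : List ℤ × ℝ | ∃ dH ∈ T, p ∈ algDescrSet dH k}.Finite ∧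
      {p : List ℤ × ℝ | ∃ dH ∈ T, p ∈ algDescrSet dH k}.ncard = (T.map fun dH => (algDescrSet dH k).ncard).sum
  | [], _, _ => by
      have he : {p : List ℤ × ℝ | ∃ dH ∈ ([] : List (ℕ × ℕ)), p ∈ algDescrSet dH k} = ∅ :=
        Set.eq_empty_iff_forall_notMem.mpr fun p hp => by simp at hp
      rw [he]; exact ⟨Set.finite_empty, by simp⟩
  | dH :: T, hnd, hfin => by
      rw [List.map_cons, List.nodup_cons] at hnd
      obtain ⟨hdT, hnd'⟩ := hnd
      obtain ⟨hf', hc'⟩ := alg_ncard_rungs k T hnd' fun x hx => hfin x (List.mem_cons_of_mem _ hx)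
      have hf1 := hfin dH (by simp)
      have hU : {p : List ℤ × ℝ | ∃ e ∈ dH :: T, p ∈ algDescrSet e k} =
          algDescrSet dH k ∪ {p : List ℤ × ℝ | ∃ e ∈ T, p ∈ algDescrSet e k} := by
        ext p
        simp only [Set.mem_setOf_eq, List.mem_cons, Set.mem_union, exists_eq_or_imp]
      have hdisj : Disjoint (algDescrSet dH k) {p : List ℤ × ℝ | ∃ e ∈ T, p ∈ algDescrSet e k} := by
        rw [Set.disjoint_left]
        rintro p hp ⟨e, he, hpe⟩
        have h1 := length_of_algDescrOK hp.1
        have h2 := length_of_algDescrOK hpe.1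
        have : dH.1 = e.1 := by omega
        exact hdT (this ▸ List.mem_map.mpr ⟨e, he, rfl⟩)
      rw [hU]
      refine ⟨hf1.union hf', ?_⟩
      rw [Set.ncard_union_eq hdisj hf1 hf', hc', List.map_cons, List.sum_cons]

/-- The eighteen rung-by-window checks, collected. [folklore] -/
theorem alg_rung_ncard (k : ℕ) (hk : k ≤ 2) : ∀ dH ∈ algTable,
    (algDescrSet dH k).Finite ∧ (algDescrSet dH k).ncard =
      (match dH.1, k with
        | 1, 0 => 6657 | 1, 1 => 9090 | 1, _ => 7468
        | 2, 0 => 6713 | 2, 1 => 9337 | 2, _ => 7802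
        | 3, 0 => 1617 | 3, 1 => 2244 | 3, _ => 1844
        | 4, 0 => 1827 | 4, 1 => 2484 | 4, _ => 2022
        | 5, 0 => 630 | 5, 1 => 857 | 5, _ => 681
        | _, 0 => 423 | _, 1 => 572 | _, _ => 443) := by
  intro dH hdH
  simp only [algTable, List.mem_cons, List.not_mem_nil, or_false] at hdH
  rcases hdH with rfl | rfl | rfl | rfl | rfl | rfl <;> interval_cases k
  · exact alg_descr_ncard_of_check le_rfl hk algSegCheck_1_0
  · exact alg_descr_ncard_of_check le_rfl hk algSegCheck_1_1
  · exact alg_descr_ncard_of_check le_rfl hk algSegCheck_1_2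
  · exact alg_descr_ncard_of_check (by norm_num) hk algSegCheck_2_0
  · exact alg_descr_ncard_of_check (by norm_num) hk algSegCheck_2_1
  · exact alg_descr_ncard_of_check (by norm_num) hk algSegCheck_2_2
  · exact alg_descr_ncard_of_check (by norm_num) hk algSegCheck_3_0
  · exact alg_descr_ncard_of_check (by norm_num) hk algSegCheck_3_1
  · exact alg_descr_ncard_of_check (by norm_num) hk algSegCheck_3_2
  · exact alg_descr_ncard_of_check (by norm_num) hk algSegCheck_4_0
  · exact alg_descr_ncard_of_check (by norm_num) hk algSegCheck_4_1
  · exact alg_descr_ncard_of_check (by norm_num) hk algSegCheck_4_2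
  · exact alg_descr_ncard_of_check (by norm_num) hk algSegCheck_5_0
  · exact alg_descr_ncard_of_check (by norm_num) hk algSegCheck_5_1
  · exact alg_descr_ncard_of_check (by norm_num) hk algSegCheck_5_2
  · exact alg_descr_ncard_of_check (by norm_num) hk algSegCheck_6_0
  · exact alg_descr_ncard_of_check (by norm_num) hk algSegCheck_6_1
  · exact alg_descr_ncard_of_check (by norm_num) hk algSegCheck_6_2

/-- **§7.3's `ALG` census numbers are kernel facts: 17 867 / 24 584 / 20 260.** The number of DESCRIPTIONS
`(P, ξ)` of the frozen table `ALG` — `P` an integer coefficient list of degree `d` and height `≤ H_d` with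
positive top coefficient and content `1`, `(d, H_d) ∈ algTable = [(1,1024), (2,64), (3,12), (4,6), (5,3),
(6,2)]`, `ξ` a real root of `P` — with `ξ` in the closed sub-window `[81/64, 13/10]`, resp. `[13/10, 27/20]`,
resp. `[27/20, 2855/2048]`, is exactly `17867`, resp. `24584`, resp. `20260` (by rung: `6657+6713+1617+1827+
630+423`, `9090+9337+2244+2484+857+572`, `7468+7802+1844+2022+681+443`; the recogniser's census of record
and the cell's independent implementations print the same numbers; here the kernel COUNTS the roots
exactly: interval-Horner sign tests, strict monotonicity from the derivative, bisection with exact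
midpoint correction, and square certificates for `(3X−4)²`, `(X³−X−1)²`). The endpoints `13/10`, `27/20`
(degree-1 descriptions) belong to two sub-windows each, as in the paper's convention. A statement about the
catalogue's density on the certified segment, NOT about `Δε`; nothing is recognised. [folklore] -/
theorem alg_descr_subwindow_ncard :
    {p : List ℤ × ℝ | ∃ dH ∈ algTable, p ∈ algDescrSet dH 0}.ncard = 17867 ∧
    {p : List ℤ × ℝ | ∃ dH ∈ algTable, p ∈ algDescrSet dH 1}.ncard = 24584 ∧
    {p : List ℤ × ℝ | ∃ dH ∈ algTable, p ∈ algDescrSet dH 2}.ncard = 20260 := by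
  have hnd : (algTable.map Prod.fst).Nodup := by decide
  refine ⟨?_, ?_, ?_⟩
  · rw [(alg_ncard_rungs 0 algTable hnd fun dH h => (alg_rung_ncard 0 (by norm_num) dH h).1).2]
    have h := fun dH h => (alg_rung_ncard 0 (by norm_num) dH h).2
    simp only [algTable, List.map_cons, List.map_nil, List.sum_cons, List.sum_nil, List.mem_cons, List.not_mem_nil,
      or_false, forall_eq_or_imp, forall_eq] at h ⊢
    obtain ⟨h1, h2, h3, h4, h5, h6⟩ := h
    omega
  · rw [(alg_ncard_rungs 1 algTable hnd fun dH h => (alg_rung_ncard 1 (by norm_num) dH h).1).2]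
    have h := fun dH h => (alg_rung_ncard 1 (by norm_num) dH h).2
    simp only [algTable, List.map_cons, List.map_nil, List.sum_cons, List.sum_nil, List.mem_cons, List.not_mem_nil,
      or_false, forall_eq_or_imp, forall_eq] at h ⊢
    obtain ⟨h1, h2, h3, h4, h5, h6⟩ := h
    omega
  · rw [(alg_ncard_rungs 2 algTable hnd fun dH h => (alg_rung_ncard 2 (by norm_num) dH h).1).2]
    have h := fun dH h => (alg_rung_ncard 2 (by norm_num) dH h).2
    simp only [algTable, List.map_cons, List.map_nil, List.sum_cons, List.sum_nil, List.mem_cons, List.not_mem_nil,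
      or_false, forall_eq_or_imp, forall_eq] at h ⊢
    obtain ⟨h1, h2, h3, h4, h5, h6⟩ := h
    omega

/-- **The set counted is finite and each root is certified exactly** (e.g. rung `(6, 2)` contributes
`423 / 572 / 443` descriptions; the square `(X³−X−1)²` counts once, in the second sub-window). [folklore] -/
theorem alg_descr_rung6_ncard :
    (algDescrSet (6, 2) 0).ncard = 423 ∧ (algDescrSet (6, 2) 1).ncard = 572 ∧ (algDescrSet (6, 2) 2).ncard = 443 :=
  ⟨(alg_rung_ncard 0 (by norm_num) (6, 2) (by simp [algTable])).2,
    (alg_rung_ncard 1 (by norm_num) (6, 2) (by simp [algTable])).2,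
    (alg_rung_ncard 2 (by norm_num) (6, 2) (by simp [algTable])).2⟩

end ColumnFaceL11
end Summit.CriticalPhenomena.Ising3D
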